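import Literature.NumberTheory.DiophantineGeometry.GenEllDeFamilyBadPrimes
import Literature.NumberTheory.DiophantineGeometry.GenEllDeBadPrimesConverse
import Literature.NumberTheory.DiophantineGeometry.GenEllDeCriticalLocusFamilyReduction
import HarnessLib

/-!
# [GenEll] Thm. 2.1 on the `D_e` route, family `t_c`: the converse `hconv` off the bad primes, grand junction

S. Mochizuki, *Arithmetic elliptic curves in general position*, Math. J. Okayama Univ. **52** (2010),
Prop. 1.6 p. 10 / proof of Thm. 2.1 pp. 12–13 [cite: MochizukiGenEll2010, Thm 2.1 proof p.13]; support
file for the route item `GenEllTwo` (stmt-ABC-19679), abc-iut-S6's OWNER RULING #6 (the family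
`t_c = 1/r + c·r^{k+1}/s`, `c ∈ ℚ^×`), W5 coordinator abc-iut-w5-d045.

The `t_c`-twin of `GenEllDeBadPrimesConverse.lean` (this seat; the case `c = 1`): abc-iut-w5-d059's
family reduction `DeCrit.exists_mem_valuation_tC_sub_lt_one'` (integrality-free form: at a place with
`w(2) = w(2k+1) = w(c) = 1` of a field in which `R_c = c²α² − β³` splits, a point with `w(N_c) < 1`
has `w(t_c(P) − t_c(Q_θ)) < 1` for some ramification point `Q_θ`) and the functoriality of the
critical values, packaged into the `hconv` shape of
`DeC.hmeet_hoff_of_gap` / `DeC.hmeet_hoff_off_badPrimes_of_subset` (abc-iut-w5-d045), uniformly in the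
test field; then the GRAND JUNCTION `DeC.hmeet_hoff_of_critValues`: `hmeet`/`hoff` of
`FibreConductor.inv_finrank_mul_sum_logNorm_le_slope` off `⋃_{p∈T} placesOver L p` for every
`T ⊇ S(e, c, B)`, from ONLY «`R_c` splits in `K`», «critical values ⊆ `B`», the normal forms, `N ≠ 0`,
`t ∉ B`, and a finite `W` of places meeting `B`.

Theorems only; classical; nothing here bears on [IUTchIII] Cor. 3.12.
-/

noncomputable section

namespace Literature.NumberTheory.DiophantineGeometry.GenEll

open _root_.Polynomial NumberField IsDedekindDomain
open Literature.IUT.LogVolume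

universe u

section Generic

variable {K : Type u} [Field K]

/-- The family normal forms force `r ≠ 0` and `s ≠ 0` (for `c ≠ 0`).
[cite: MochizukiGenEll2010, Thm 2.1 proof p.13] -/
theorem DeC.r_ne_zero_and_s_ne_zero {L : Type*} [Field L] (k : ℕ) {c r s t : L} (hc : c ≠ 0)
    (hcurve : s ^ 2 = 1 - 4 * r ^ (2 * k + 1)) (ht : t * (r * s) = s + c * r ^ (k + 2)) :
    r ≠ 0 ∧ s ≠ 0 := by
  have hr : r ≠ 0 := by
    rintro rfl
    have hs : s ^ 2 = 1 := by rw [hcurve]; simp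
    have hs0 : s = 0 := by
      have h := ht
      rw [zero_mul, mul_zero, zero_pow (by omega : k + 2 ≠ 0), mul_zero, add_zero] at h
      exact h.symm
    rw [hs0] at hs; norm_num at hs
  refine ⟨hr, ?_⟩
  rintro rfl
  have h := ht
  rw [mul_zero, mul_zero, zero_add] at h
  exact hr ((pow_eq_zero_iff (by omega : k + 2 ≠ 0)).mp ((mul_eq_zero.mp h.symm).resolve_left hc))

/-- A root of `R_c` in `L ⊇ K` comes from a root in `K` when `R_c` splits in `K`.
[cite: MochizukiGenEll2010, Thm 2.1 proof p.13] -/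
theorem DeC.exists_root_eq_algebraMap (k : ℕ) {L : Type*} [Field L] [Algebra K L] {c : K}
    (hsplit : (DeCrit.RpolyC k c).Splits) {θ : L}
    (hθ : (DeCrit.RpolyC k (algebraMap K L c)).eval θ = 0) :
    ∃ θ₀ : K, (DeCrit.RpolyC k c).eval θ₀ = 0 ∧ algebraMap K L θ₀ = θ := by
  have hmem : θ ∈ ((DeCrit.RpolyC k c).map (algebraMap K L)).roots := by
    rw [mem_roots ((Polynomial.map_ne_zero_iff (algebraMap K L).injective).mpr
      (DeCrit.RpolyC_ne_zero k c)), IsRoot.def, DeCrit.map_RpolyC]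
    exact hθ
  rw [hsplit.roots_map (algebraMap K L), Multiset.mem_map] at hmem
  obtain ⟨θ₀, hθ₀, rfl⟩ := hmem
  refine ⟨θ₀, ?_, rfl⟩
  rw [mem_roots (DeCrit.RpolyC_ne_zero k c), IsRoot.def] at hθ₀
  exact hθ₀

/-- The critical value `t_c(Q_θ)` is functorial in the field. [cite: MochizukiGenEll2010, Thm 2.1 proof p.13] -/
theorem DeC.algebraMap_critValue (k : ℕ) {L : Type*} [Field L] [Algebra K L] (c θ : K) :
    algebraMap K L (((1 - 2 * DeCrit.critXC k c θ) + c * θ ^ (k + 2)) /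
        (θ * (1 - 2 * DeCrit.critXC k c θ))) =
      ((1 - 2 * DeCrit.critXC k (algebraMap K L c) (algebraMap K L θ)) +
          algebraMap K L c * (algebraMap K L θ) ^ (k + 2)) /
        (algebraMap K L θ * (1 - 2 * DeCrit.critXC k (algebraMap K L c) (algebraMap K L θ))) := by
  rw [← DeCrit.map_critXC (algebraMap K L) k c θ]
  simp [map_div₀, map_sub, map_add, map_mul, map_pow, map_ofNat]

end Generic

section Converse

variable {K : Type u} [Field K] [NumberField K]

open scoped Classical in
/-- **The family converse `hconv` off the bad primes.** Let `c ∈ K^×` and let `B ⊂ K` contain the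
critical values `t_c(Q_θ)`, `θ` ranging over the roots of `R_c = c²α² − β³`, all in `K` (`R_c` splits in
`K`). There is a finite set `S ∋ 2` of primes (the prime factors of `2(2k+1)` and of a unit modulus of `c`)
such that for every number field `L ⊇ K`, every finite `T ⊇ S`, every finite place `w` of `L` not over
`T`, and every point datum `(r, s, t, N)` in the family normal forms (`t·rs = s + c·r^{k+2}`,
`N = −s³ + c((k+1)r^{k+2} − 2r^{3k+3})`): `w(N) < 1 ⇒ ∃ b ∈ B, w(t − b) < 1`
(abc-iut-w5-d059's `DeCrit.exists_mem_valuation_tC_sub_lt_one'` read over `L`, with the unit modulus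
of `c` and the functoriality of the critical values). [cite: MochizukiGenEll2010, Thm 2.1 proof p.13] -/
theorem DeC.hconv_off_badPrimes (k : ℕ) {c : K} (hc : c ≠ 0) (B : Finset K)
    (hsplit : (DeCrit.RpolyC k c).Splits)
    (hcritB : ∀ θ : K, (DeCrit.RpolyC k c).eval θ = 0 →
      ((1 - 2 * DeCrit.critXC k c θ) + c * θ ^ (k + 2)) / (θ * (1 - 2 * DeCrit.critXC k c θ)) ∈ B) :
    ∃ S : Finset ℕ, 2 ∈ S ∧ (∀ p ∈ S, p.Prime) ∧
      ∀ (L : Type u) [Field L] [NumberField L] [Algebra K L] (T : Finset ℕ), S ⊆ T →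
        ∀ (w : HeightOneSpectrum (𝓞 L)), w ∉ T.attach.biUnion (fun p => placesOver L p.1) →
        ∀ {r s t N : L},
        s ^ 2 = 1 - 4 * r ^ (2 * k + 1) → t * (r * s) = s + algebraMap K L c * r ^ (k + 2) →
        N = -s ^ 3 + algebraMap K L c * ((k + 1) * r ^ (k + 2) - 2 * r ^ (3 * k + 3)) →
        w.valuation L N < 1 →
          ∃ b ∈ B.map ⟨algebraMap K L, (algebraMap K L).injective⟩, w.valuation L (t - b) < 1 := by
  classical
  -- unit modulus for `c`
  obtain ⟨d, hd0, hd⟩ := exists_modulus_valuation_eq_one (K := K) {c} (by simpa using hc)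
  set D : ℕ := 2 * (2 * k + 1) * d with hDdef
  have hD0 : D ≠ 0 := by positivity
  refine ⟨D.primeFactors, Nat.mem_primeFactors.mpr ⟨Nat.prime_two, ⟨(2 * k + 1) * d, by ring⟩, hD0⟩,
    fun p hp => Nat.prime_of_mem_primeFactors hp, ?_⟩
  intro L _ _ _ T hST w hw r s t N hcurve ht hN hNlt
  have hwD : w ∉ D.primeFactors.attach.biUnion (fun p => placesOver L p.1) := by
    intro hmem
    obtain ⟨p, -, hp⟩ := Finset.mem_biUnion.mp hmem
    exact hw (Finset.mem_biUnion.mpr ⟨⟨p.1, hST p.2⟩, Finset.mem_attach _ _, hp⟩)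
  have hval : w.valuation L (D : L) = 1 := valuation_natCast_eq_one_of_not_mem_biUnion w hD0 hwD
  have h2 : w.valuation L (2 : L) = 1 := by
    have h := valuation_natCast_eq_one_of_dvd w (⟨(2 * k + 1) * d, by ring⟩ : 2 ∣ D) hval
    simpa using h
  have he : w.valuation L ((2 * k + 1 : ℕ) : L) = 1 :=
    valuation_natCast_eq_one_of_dvd w (⟨2 * d, by ring⟩ : (2 * k + 1) ∣ D) hval
  have hdv : w.valuation L (d : L) = 1 :=
    valuation_natCast_eq_one_of_dvd w (⟨2 * (2 * k + 1), by ring⟩ : d ∣ D) hval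
  have hcv : w.valuation L (algebraMap K L c) = 1 := hd L w hdv c (by simp)
  set c' : L := algebraMap K L c with hc'def
  have hc' : c' ≠ 0 := (_root_.map_ne_zero (algebraMap K L)).mpr hc
  obtain ⟨hr0, hs0⟩ := DeC.r_ne_zero_and_s_ne_zero k hc' hcurve ht
  -- coordinates `(x, r)` and the vocabulary of the family reduction
  set x : L := (1 - s) / 2 with hxdef
  have h2L : (2 : L) ≠ 0 := two_ne_zero
  have hx : 1 - 2 * x = s := by rw [hxdef]; field_simp; ring
  have hcx : r ^ (2 * k + 1) = x * (1 - x) := by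
    have e : x * (1 - x) = (1 - s ^ 2) / 4 := by rw [hxdef]; field_simp; ring
    rw [e, hcurve]; ring
  have hNval : DeCrit.NvalC k c' (x, r) = N := by
    rw [hN, DeCrit.NvalC, DeCrit.alpha, hx]
  have htdiv : t = (s + c' * r ^ (k + 2)) / (r * s) := by
    rw [eq_div_iff (mul_ne_zero hr0 hs0)]; exact ht
  have hsplitL : (DeCrit.RpolyC k c').Splits := by
    rw [hc'def, ← DeCrit.map_RpolyC (algebraMap K L) k c]
    exact hsplit.map _
  -- the critical values of `t_{c'}` over `L` are the images of those over `K`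
  have hcritL : ∀ θ : L, (DeCrit.RpolyC k c').eval θ = 0 →
      ((1 - 2 * DeCrit.critXC k c' θ) + c' * θ ^ (k + 2)) / (θ * (1 - 2 * DeCrit.critXC k c' θ)) ∈
        ((B.map ⟨algebraMap K L, (algebraMap K L).injective⟩ : Finset L) : Set L) := by
    intro θ hθ
    obtain ⟨θ₀, hθ₀, rfl⟩ := DeC.exists_root_eq_algebraMap k hsplit hθ
    rw [Finset.mem_coe, Finset.mem_map]
    exact ⟨_, hcritB θ₀ hθ₀, DeC.algebraMap_critValue k c θ₀⟩
  have hNlt' : w.valuation L (DeCrit.NvalC k c' (x, r)) < 1 := by rw [hNval]; exact hNlt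
  obtain ⟨b, hb, hclose⟩ :=
    DeCrit.exists_mem_valuation_tC_sub_lt_one' (w.valuation L) k h2 he hcv hsplitL _ hcritL hcx hNlt'
  refine ⟨b, Finset.mem_coe.mp hb, ?_⟩
  rw [htdiv, ← hx]
  exact hclose

open scoped Classical in
/-- **GRAND JUNCTION for the family `t_c`: `hmeet`/`hoff` from the critical values alone.** For `k`,
`c ∈ K^×` and a finite `B ⊂ K` containing the critical values of `t_c` (`R_c` split in `K`) there is a
finite set `S ∋ 2` of primes such that for every number field `L ⊇ K`, every finite `T ⊇ S`, every point
datum `(r, s, t, N)` in the family normal forms with `N ≠ 0` and `t ∉ B`, and every finite set `W` of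
places meeting `B` off `Sbad := ⋃_{p∈T} placesOver L p`: on `W ∖ Sbad`,
`1 + ord⁺_w N ≤ Σ_{b∈B} ord⁺_w (t − b)`, and off `W ∪ Sbad`, `ord⁺_w N ≤ Σ_{b∈B} ord⁺_w (t − b)` — the
hypotheses `hmeet`/`hoff` of `FibreConductor.inv_finrank_mul_sum_logNorm_le_slope` with no residual local
hypothesis (`DeC.hmeet_hoff_off_badPrimes_of_subset` of abc-iut-w5-d045 ∘ `DeC.hconv_off_badPrimes`).
[cite: MochizukiGenEll2010, Thm 2.1 proof p.13] -/
theorem DeC.hmeet_hoff_of_critValues (k : ℕ) {c : K} (hc : c ≠ 0) (B : Finset K)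
    (hsplit : (DeCrit.RpolyC k c).Splits)
    (hcritB : ∀ θ : K, (DeCrit.RpolyC k c).eval θ = 0 →
      ((1 - 2 * DeCrit.critXC k c θ) + c * θ ^ (k + 2)) / (θ * (1 - 2 * DeCrit.critXC k c θ)) ∈ B) :
    ∃ S : Finset ℕ, 2 ∈ S ∧ (∀ p ∈ S, p.Prime) ∧
      ∀ (L : Type u) [Field L] [NumberField L] [Algebra K L] (T : Finset ℕ), S ⊆ T →
        ∀ {r s t N : L},
        s ^ 2 = 1 - 4 * r ^ (2 * k + 1) → t * (r * s) = s + algebraMap K L c * r ^ (k + 2) →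
        N = -s ^ 3 + algebraMap K L c * ((k + 1) * r ^ (k + 2) - 2 * r ^ (3 * k + 3)) → N ≠ 0 →
        (∀ b ∈ B, t ≠ algebraMap K L b) →
        ∀ W : Finset (HeightOneSpectrum (𝓞 L)),
        (∀ w ∈ W, w ∉ T.attach.biUnion (fun p => placesOver L p.1) →
          ∃ b ∈ B.map ⟨algebraMap K L, (algebraMap K L).injective⟩, 0 < ord L w (t - b)) →
        (∀ w ∈ W, w ∉ T.attach.biUnion (fun p => placesOver L p.1) →
            1 + (ord L w N).toNat ≤
              ∑ b ∈ B.map ⟨algebraMap K L, (algebraMap K L).injective⟩, (ord L w (t - b)).toNat) ∧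
        (∀ w, w ∉ W → w ∉ T.attach.biUnion (fun p => placesOver L p.1) →
            (ord L w N).toNat ≤
              ∑ b ∈ B.map ⟨algebraMap K L, (algebraMap K L).injective⟩, (ord L w (t - b)).toNat) := by
  classical
  obtain ⟨S₀, h2S₀, hS₀p, hS₀⟩ := DeC.hmeet_hoff_off_badPrimes_of_subset (K := K) k hc B
  obtain ⟨S₁, -, hS₁p, hS₁⟩ := DeC.hconv_off_badPrimes (K := K) k hc B hsplit hcritB
  refine ⟨S₀ ∪ S₁, Finset.mem_union_left _ h2S₀, ?_, ?_⟩
  · intro p hp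
    rcases Finset.mem_union.mp hp with h | h
    · exact hS₀p p h
    · exact hS₁p p h
  intro L _ _ _ T hST r s t N hcurve ht hN hN0 htB W hW
  have hS₀T : S₀ ⊆ T := fun p hp => hST (Finset.mem_union_left _ hp)
  have hS₁T : S₁ ⊆ T := fun p hp => hST (Finset.mem_union_right _ hp)
  exact hS₀ L T hS₀T hcurve ht hN hN0 htB W
    (fun w hw hNlt => hS₁ L T hS₁T w hw hcurve ht hN hNlt) hW

end Converse

end Literature.NumberTheory.DiophantineGeometry.GenEll
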